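import Summits.ResolutionOfSingularities.ResolutionOfSingularities.Theorems.EquisingularLiftEquisingularLiftNatExceptionalLineCone
import HarnessLib

/-!
# `EquisingularLiftNat`, line `sections`, stub `stub_elnat_three` — helper AVOID-L1 / M10
# `EquimultipleAlongTrace`: the bad point of a Δ-step lies on the strict transform iff the
# hypersurface is not equimultiple at the singular point of the trace

[OURS · L1 W4.5b] Helper statement AVOID (= L1 of CRUX-PLAN v1.1 §3.4, CRUX-PLAN v3 §4; closed form
M10 `EquimultipleAlongTrace` of tri-1's TRIAGE v3 §−3.B/§3) for the research stub `stub_elnat_three` of the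
registered line `sections` of the crux item `EquisingularLiftNat` = stmt-ResolutionOfSingularities-20038
(chain w45b); NOT a statement of any manuscript. Companion of the H-CONE file
`…Theorems.EquisingularLiftEquisingularLiftNatExceptionalLineCone` (same chart algebra).

SETTING (tri-1 §−3.B, by hand there; kernel-checked here on the chart). Downstairs, a Δ-step blows up
the regular threefold germ `P′_k` at `q` along the TRACE `D = V(z, ḡ)` of the Δ-centre: `z` = the carrier
plane, `ḡ ∈ 𝔪_q²` = the (reduced, singular at `q`) plane curve. On the chart `S = 1` of
`Bl_D = {zT = ḡS}`, i.e. the affine blowup algebra `R[I/z]` (`I = (z, g)`, `T = g/z`), the only non-smooth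
point of the blow-up over `q` is the BAD POINT `b_q = (𝔪_q, T)`. A hypersurface `Y′ = V(F)` with
`F ∈ I^m` of generic multiplicity `m` along `D` has the NORMAL FORM `F ≡ Σ_{k=0}^{m} a_k z^{m-k} g^k
(mod I^{m+1})`, and on the chart `F = z^m · F′`, `F′ ≡ Σ a_k T^k (mod z)`. CLAIM (M10):
`b_q ∈ St(Y′) ⟺ a₀ ∈ 𝔪_q ⟺ mult_q(Y′) ≥ m + 1`; i.e. **AVOID ⟺ EQUIMULTIPLICITY**: the strict transform
misses the bad point iff `Y′` has multiplicity exactly `m` at `q`.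

PROVED HERE (part 1; for an arbitrary commutative ring `R`, ideal `I`, `g ∈ I`, chart element `z` — no
hypothesis on `R`):

* `exists_controlledTransform_of_normalForm`, `controlledTransform_sub_sum_mem_span` — the controlled
  transform `F′` (`F = z^m F′` on `R[I/z]`, unique) satisfies `F′ - Σ a_k (g/z)^k ∈ (z)`;
* `controlledTransform_sub_coeff_zero_mem` — `F′ - a₀ ∈ (z, g/z)`; hence
  `controlledTransform_mem_badPoint` — `a₀ ∈ 𝔪 ∋ z` ⟹ `F′ ∈ 𝔪·R[I/z] + (g/z)` (the controlled, hence
  the strict, transform passes through `b_q`), and **AVOID** `eq_top_of_controlledTransform_mem` — if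
  `a₀` is a unit then NO proper ideal containing `z` and `g/z` contains `F′`: the strict transform
  `⊆ V(F′)` misses the bad point;
* `mem_span_of_pow_mul_mem_of_regular_mod`, `ker_mapQuotient_eq_span_of_regular_mod` — STRICT =
  CONTROLLED: if `F′` is a non-zero-divisor modulo `(z)` then `(F′)` is `z`-saturated, so it IS the
  kernel of the chart map `R[I/z] → (R/(F))[Ī/z̄]` onto the chart ring of the blow-up of the
  hypersurface (no primality of `z` needed — the trace `D` may be reducible, e.g. NODAL, which is the
  case of interest for Δ-centres).

PART 2 (`…Theorems.EquisingularLiftEquisingularLiftNatEquimultipleAlongTraceRegular`): the converse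
`F′ ∈ 𝔪·R[I/z] + (g/z) ⟹ a₀ ∈ 𝔪` for quasi-regular `(z, g)` (Stacks 0BIQ), McCoy (`F′` regular mod `z`
when the `a_k` have no common annihilator mod `I`), M10 on the chart, and the regular-local-ring reading
`F ∈ 𝔪^{m+1} ⟺ a₀ ∈ 𝔪`, i.e. `b_q ∈ St(Y′) ⟺ mult_q(Y′) ≥ m + 1`.

All statements are [folklore]-level commutative algebra (Stacks 052Q/0BIQ charts; Matsumura Thm. 16.2
(i) for quasi-regularity of parameters); axioms standard.
-/

set_option linter.dupNamespace false -- mandated namespace `Summit.<Summit>.<Problem>` of this single-conjunct summit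

noncomputable section

namespace Summit.ResolutionOfSingularities.ResolutionOfSingularities.Cruxes.EquisingularLiftNat.Sections

open IsLocalization Literature.AlgebraicGeometry.Resolution

universe u

variable {R : Type u} [CommRing R]

/-! ## The controlled transform of a normal form `Σ a_k z^{m-k} g^k` on the chart `R[I/z]` -/

/-- `z^m · (g/z)^k = z^{m-k} g^k` in `R[1/z]` for `k ≤ m`. [folklore] -/
theorem algebraMap_pow_mul_div_pow (z g : R) {m k : ℕ} (hk : k ≤ m) :
    algebraMap R (Localization.Away z) z ^ m *
        (algebraMap R (Localization.Away z) g * Away.invSelf z) ^ k =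
      algebraMap R (Localization.Away z) (z ^ (m - k) * g ^ k) := by
  have h1 : algebraMap R (Localization.Away z) z ^ m =
      algebraMap R (Localization.Away z) z ^ (m - k) * algebraMap R (Localization.Away z) z ^ k := by
    rw [← pow_add, Nat.sub_add_cancel hk]
  rw [h1, map_mul, map_pow, map_pow, mul_pow]
  calc algebraMap R (Localization.Away z) z ^ (m - k) * algebraMap R (Localization.Away z) z ^ k *
        (algebraMap R (Localization.Away z) g ^ k * Away.invSelf z ^ k)
      = algebraMap R (Localization.Away z) z ^ (m - k) * algebraMap R (Localization.Away z) g ^ k *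
          (algebraMap R (Localization.Away z) z * Away.invSelf z) ^ k := by ring
    _ = _ := by rw [Away.mul_invSelf, one_pow, mul_one]

/-- **The controlled transform of a normal form.** If `g ∈ I` and
`F - Σ_{k ≤ m} a_k z^{m-k} g^k ∈ I^{m+1}`, then on the chart `R[I/z]` one has `F = z^m · F′` with
`F′ - Σ_{k ≤ m} a_k (g/z)^k ∈ (z)` (namely `F′ = Σ a_k (g/z)^k + z · (remainder / z^{m+1})`).
[cite: StacksProject, Tag 052Q] -/
theorem exists_controlledTransform_of_normalForm (I : Ideal R) (z : R) {g : R} (hg : g ∈ I)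
    (m : ℕ) (a : ℕ → R) {F : R}
    (hF : F - ∑ k ∈ Finset.range (m + 1), a k * z ^ (m - k) * g ^ k ∈ I ^ (m + 1)) :
    ∃ F' : blowupAlgebra I z,
      algebraMap R (blowupAlgebra I z) F = algebraMap R (blowupAlgebra I z) z ^ m * F' ∧
      F' - ∑ k ∈ Finset.range (m + 1),
          algebraMap R (blowupAlgebra I z) (a k) * blowupAlgebra.gen I z g hg ^ k ∈
        Ideal.span {algebraMap R (blowupAlgebra I z) z} := by
  -- the remainder divided by `z^{m+1}`
  let G' : blowupAlgebra I z :=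
    ⟨algebraMap R (Localization.Away z) (F - ∑ k ∈ Finset.range (m + 1), a k * z ^ (m - k) * g ^ k) *
        Away.invSelf z ^ (m + 1),
      algebraMap_mul_invSelf_pow_mem_blowupAlgebra (I := I) (a := z) (m + 1) hF⟩
  refine ⟨∑ k ∈ Finset.range (m + 1),
      algebraMap R (blowupAlgebra I z) (a k) * blowupAlgebra.gen I z g hg ^ k +
      algebraMap R (blowupAlgebra I z) z * G', ?_, ?_⟩
  · -- all identities are checked inside `R[I/z]`, using `z · (g/z) = g`
    have hT : algebraMap R (blowupAlgebra I z) z * blowupAlgebra.gen I z g hg =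
        algebraMap R (blowupAlgebra I z) g := blowupAlgebra.algebraMap_mul_gen I z g hg
    have hterm : ∀ k ∈ Finset.range (m + 1),
        algebraMap R (blowupAlgebra I z) z ^ m *
            (algebraMap R (blowupAlgebra I z) (a k) * blowupAlgebra.gen I z g hg ^ k) =
          algebraMap R (blowupAlgebra I z) (a k * z ^ (m - k) * g ^ k) := by
      intro k hk
      have hkm : k ≤ m := Nat.lt_succ_iff.mp (Finset.mem_range.mp hk)
      have hzpow : algebraMap R (blowupAlgebra I z) z ^ m =
          algebraMap R (blowupAlgebra I z) z ^ (m - k) * algebraMap R (blowupAlgebra I z) z ^ k := by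
        rw [← pow_add, Nat.sub_add_cancel hkm]
      rw [hzpow, map_mul, map_mul, map_pow, map_pow, ← hT, mul_pow]
      ring
    have hrem : algebraMap R (blowupAlgebra I z) z ^ (m + 1) * G' =
        algebraMap R (blowupAlgebra I z)
          (F - ∑ k ∈ Finset.range (m + 1), a k * z ^ (m - k) * g ^ k) := by
      apply Subtype.ext
      change algebraMap R (Localization.Away z) z ^ (m + 1) *
          (algebraMap R (Localization.Away z)
              (F - ∑ k ∈ Finset.range (m + 1), a k * z ^ (m - k) * g ^ k) *
            Away.invSelf z ^ (m + 1)) =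
        algebraMap R (Localization.Away z) (F - ∑ k ∈ Finset.range (m + 1), a k * z ^ (m - k) * g ^ k)
      calc _ = (algebraMap R (Localization.Away z) z * Away.invSelf z) ^ (m + 1) *
            algebraMap R (Localization.Away z)
              (F - ∑ k ∈ Finset.range (m + 1), a k * z ^ (m - k) * g ^ k) := by ring
        _ = _ := by rw [Away.mul_invSelf, one_pow, one_mul]
    rw [mul_add, Finset.mul_sum, Finset.sum_congr rfl hterm, ← map_sum,
      show algebraMap R (blowupAlgebra I z) z ^ m * (algebraMap R (blowupAlgebra I z) z * G') =
        algebraMap R (blowupAlgebra I z) z ^ (m + 1) * G' by rw [pow_succ]; ring,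
      hrem, ← map_add, add_sub_cancel]
  · rw [add_sub_cancel_left]
    exact Ideal.mul_mem_right _ _ (Ideal.mem_span_singleton_self _)

/-- Every `F′` with `F = z^m F′` on `R[I/z]` satisfies `F′ - Σ a_k (g/z)^k ∈ (z)` (`F′` is unique,
`controlledTransform_unique`). [folklore] -/
theorem controlledTransform_sub_sum_mem_span (I : Ideal R) (z : R) {g : R} (hg : g ∈ I)
    (m : ℕ) (a : ℕ → R) {F : R}
    (hF : F - ∑ k ∈ Finset.range (m + 1), a k * z ^ (m - k) * g ^ k ∈ I ^ (m + 1))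
    {F' : blowupAlgebra I z}
    (hF' : algebraMap R (blowupAlgebra I z) F = algebraMap R (blowupAlgebra I z) z ^ m * F') :
    F' - ∑ k ∈ Finset.range (m + 1),
        algebraMap R (blowupAlgebra I z) (a k) * blowupAlgebra.gen I z g hg ^ k ∈
      Ideal.span {algebraMap R (blowupAlgebra I z) z} := by
  obtain ⟨F'', hF'', hmem⟩ := exists_controlledTransform_of_normalForm I z hg m a hF
  rwa [controlledTransform_unique I z hF' hF'']

/-- `F′ - a₀ ∈ (z, g/z)`: modulo the exceptional equation `z` and the chart coordinate `T = g/z` the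
controlled transform is the constant `a₀`. [folklore] -/
theorem controlledTransform_sub_coeff_zero_mem (I : Ideal R) (z : R) {g : R} (hg : g ∈ I)
    (m : ℕ) (a : ℕ → R) {F : R}
    (hF : F - ∑ k ∈ Finset.range (m + 1), a k * z ^ (m - k) * g ^ k ∈ I ^ (m + 1))
    {F' : blowupAlgebra I z}
    (hF' : algebraMap R (blowupAlgebra I z) F = algebraMap R (blowupAlgebra I z) z ^ m * F') :
    F' - algebraMap R (blowupAlgebra I z) (a 0) ∈
      Ideal.span {algebraMap R (blowupAlgebra I z) z, blowupAlgebra.gen I z g hg} := by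
  have h := controlledTransform_sub_sum_mem_span I z hg m a hF hF'
  -- split off the constant term of the sum
  rw [Finset.sum_range_succ', pow_zero, mul_one] at h
  have hT : ∑ k ∈ Finset.range m,
      algebraMap R (blowupAlgebra I z) (a (k + 1)) * blowupAlgebra.gen I z g hg ^ (k + 1) ∈
      Ideal.span {algebraMap R (blowupAlgebra I z) z, blowupAlgebra.gen I z g hg} := by
    refine Ideal.sum_mem _ fun k _ => ?_
    rw [pow_succ, ← mul_assoc]
    exact Ideal.mul_mem_left _ _ (Ideal.subset_span (Set.mem_insert_of_mem _ rfl))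
  have hz : F' - (∑ k ∈ Finset.range m,
      algebraMap R (blowupAlgebra I z) (a (k + 1)) * blowupAlgebra.gen I z g hg ^ (k + 1) +
        algebraMap R (blowupAlgebra I z) (a 0)) ∈
      Ideal.span {algebraMap R (blowupAlgebra I z) z, blowupAlgebra.gen I z g hg} :=
    Ideal.span_mono (Set.singleton_subset_iff.mpr (Set.mem_insert _ _)) h
  have := Ideal.add_mem _ hz hT
  convert this using 1
  ring

/-- **The non-equimultiple case passes through the bad point.** If `a₀ ∈ 𝔪` for an ideal `𝔪 ∋ z`
of `R`, then `F′ ∈ 𝔪·R[I/z] + (g/z)` — the controlled transform (hence also the strict transform,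
which it contains) vanishes at the bad point `b_q = (𝔪, g/z)` of the chart. [folklore] -/
theorem controlledTransform_mem_badPoint (I : Ideal R) (z : R) {g : R} (hg : g ∈ I)
    (m : ℕ) (a : ℕ → R) {F : R}
    (hF : F - ∑ k ∈ Finset.range (m + 1), a k * z ^ (m - k) * g ^ k ∈ I ^ (m + 1))
    {F' : blowupAlgebra I z}
    (hF' : algebraMap R (blowupAlgebra I z) F = algebraMap R (blowupAlgebra I z) z ^ m * F')
    (𝔪 : Ideal R) (hz : z ∈ 𝔪) (ha : a 0 ∈ 𝔪) :
    F' ∈ 𝔪.map (algebraMap R (blowupAlgebra I z)) ⊔ Ideal.span {blowupAlgebra.gen I z g hg} := by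
  have h := controlledTransform_sub_coeff_zero_mem I z hg m a hF hF'
  have hle : Ideal.span {algebraMap R (blowupAlgebra I z) z, blowupAlgebra.gen I z g hg} ≤
      𝔪.map (algebraMap R (blowupAlgebra I z)) ⊔ Ideal.span {blowupAlgebra.gen I z g hg} := by
    rw [Ideal.span_insert]
    exact sup_le_sup_right ((Ideal.span_singleton_le_iff_mem _).mpr (Ideal.mem_map_of_mem _ hz)) _
  have h1 : F' = (F' - algebraMap R (blowupAlgebra I z) (a 0)) + algebraMap R (blowupAlgebra I z) (a 0) := by
    ring
  rw [h1]
  exact Ideal.add_mem _ (hle h) (Ideal.mem_sup_left (Ideal.mem_map_of_mem _ ha))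

/-- **AVOID (the equimultiple case misses the bad point).** If the constant coefficient `a₀` of the
normal form is a unit, then no proper ideal of `R[I/z]` containing `z` and `g/z` contains `F′`: every
point of the chart with `z = 0`, `g/z = 0` — in particular the bad point `b_q` — lies off `V(F′)`, hence
off the strict transform `⊆ V(F′)` of `V(F)`. No hypothesis on `R`. [folklore] -/
theorem eq_top_of_controlledTransform_mem (I : Ideal R) (z : R) {g : R} (hg : g ∈ I)
    (m : ℕ) (a : ℕ → R) {F : R}
    (hF : F - ∑ k ∈ Finset.range (m + 1), a k * z ^ (m - k) * g ^ k ∈ I ^ (m + 1))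
    {F' : blowupAlgebra I z}
    (hF' : algebraMap R (blowupAlgebra I z) F = algebraMap R (blowupAlgebra I z) z ^ m * F')
    (ha : IsUnit (a 0)) (𝔐 : Ideal (blowupAlgebra I z))
    (hz : algebraMap R (blowupAlgebra I z) z ∈ 𝔐) (hT : blowupAlgebra.gen I z g hg ∈ 𝔐)
    (hF𝔐 : F' ∈ 𝔐) : 𝔐 = ⊤ := by
  have h := controlledTransform_sub_coeff_zero_mem I z hg m a hF hF'
  have hle : Ideal.span {algebraMap R (blowupAlgebra I z) z, blowupAlgebra.gen I z g hg} ≤ 𝔐 := by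
    rw [Ideal.span_le, Set.insert_subset_iff, Set.singleton_subset_iff]
    exact ⟨hz, hT⟩
  have ha0 : algebraMap R (blowupAlgebra I z) (a 0) ∈ 𝔐 := by
    have := Ideal.sub_mem _ hF𝔐 (hle h)
    rwa [sub_sub_cancel] at this
  exact Ideal.eq_top_of_isUnit_mem _ ha0 (ha.map _)

/-! ## Strict transform = controlled transform when `F′` is regular modulo `z` -/

/-- **`(F′)` is `z`-saturated when `F′` is a non-zero-divisor modulo `(z)`**: `z` is a non-zero-divisor
of `R[I/z]`, so `zᴺ h ∈ (F′)` forces `h ∈ (F′)`. [folklore] -/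
theorem mem_span_of_pow_mul_mem_of_regular_mod (I : Ideal R) (z : R) {F' : blowupAlgebra I z}
    (hreg : ∀ c : blowupAlgebra I z, F' * c ∈ Ideal.span {algebraMap R (blowupAlgebra I z) z} →
      c ∈ Ideal.span {algebraMap R (blowupAlgebra I z) z}) :
    ∀ (N : ℕ) (h : blowupAlgebra I z),
      algebraMap R (blowupAlgebra I z) z ^ N * h ∈ Ideal.span {F'} → h ∈ Ideal.span {F'} := by
  intro N
  induction N with
  | zero => intro h hh; simpa using hh
  | succ N ih =>
    intro h hh
    -- `z^{N+1} h = F' c`; modulo `z`, `F' c ≡ 0`, so `c = z c₁` and `z^N h = F' c₁`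
    obtain ⟨c, hc⟩ := Ideal.mem_span_singleton'.mp hh
    have e1 : F' * c = algebraMap R (blowupAlgebra I z) z ^ (N + 1) * h := by
      rw [mul_comm]; exact hc
    have hcz : c ∈ Ideal.span {algebraMap R (blowupAlgebra I z) z} :=
      hreg c (Ideal.mem_span_singleton'.mpr
        ⟨algebraMap R (blowupAlgebra I z) z ^ N * h, by rw [e1, pow_succ]; ring⟩)
    obtain ⟨c₁, hc₁⟩ := Ideal.mem_span_singleton'.mp hcz
    apply ih
    have hreg' := algebraMap_mem_nonZeroDivisors_blowupAlgebra (I := I) (a := z)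
    have e2 : algebraMap R (blowupAlgebra I z) z * (c₁ * F') =
        algebraMap R (blowupAlgebra I z) z * (algebraMap R (blowupAlgebra I z) z ^ N * h) := by
      calc algebraMap R (blowupAlgebra I z) z * (c₁ * F')
          = (c₁ * algebraMap R (blowupAlgebra I z) z) * F' := by ring
        _ = c * F' := by rw [hc₁]
        _ = algebraMap R (blowupAlgebra I z) z ^ (N + 1) * h := hc
        _ = algebraMap R (blowupAlgebra I z) z * (algebraMap R (blowupAlgebra I z) z ^ N * h) := by
            rw [pow_succ]; ring
    exact Ideal.mem_span_singleton'.mpr ⟨c₁, (mul_cancel_left_mem_nonZeroDivisors hreg').mp e2⟩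

/-- **Strict transform = `V(F′)`.** If `F = z^m F′` on `R[I/z]` and `F′` is a non-zero-divisor modulo
`(z)`, the kernel of the chart map `R[I/z] → (R/(F))[Ī/z̄]` onto the chart ring of the blow-up of the
hypersurface `R/(F)` — the `z`-saturation of `(F)` — is `(F′)`. No primality of `z` is needed (the trace
of the centre may be reducible). [cite: GortzWedhorn2020, Prop. 13.96 (2) and p. 416] -/
theorem ker_mapQuotient_eq_span_of_regular_mod (I : Ideal R) (z : R) {F : R} {m : ℕ}
    {F' : blowupAlgebra I z}
    (hF' : algebraMap R (blowupAlgebra I z) F = algebraMap R (blowupAlgebra I z) z ^ m * F')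
    (hreg : ∀ c : blowupAlgebra I z, F' * c ∈ Ideal.span {algebraMap R (blowupAlgebra I z) z} →
      c ∈ Ideal.span {algebraMap R (blowupAlgebra I z) z}) :
    RingHom.ker (blowupAlgebra.mapQuotient I z (Ideal.span {F})) = Ideal.span {F'} := by
  apply le_antisymm
  · intro h hh
    obtain ⟨N, hN⟩ := (blowupAlgebra.mem_ker_mapQuotient_iff I z (Ideal.span {F}) h).mp hh
    rw [Ideal.map_span, Set.image_singleton, hF'] at hN
    refine mem_span_of_pow_mul_mem_of_regular_mod I z hreg N h ?_
    exact (Ideal.span_singleton_le_iff_mem _).mpr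
      (Ideal.mul_mem_left _ _ (Ideal.mem_span_singleton_self F')) hN
  · rw [Ideal.span_singleton_le_iff_mem, blowupAlgebra.mem_ker_mapQuotient_iff]
    refine ⟨m, ?_⟩
    rw [← hF', Ideal.map_span, Set.image_singleton]
    exact Ideal.mem_span_singleton_self _

end Summit.ResolutionOfSingularities.ResolutionOfSingularities.Cruxes.EquisingularLiftNat.Sections

end
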